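import Summits.QuantumFields.YangMills.Theses.FirstExitWindow
import Summits.QuantumFields.YangMills.Theorems.SmallFieldWideningLargeFieldMassRefinementTailOfHeightTail
import Summits.QuantumFields.YangMills.Theorems.FibreConvexityTailHistoryTailOfTwoSided

/-!
# Route `SmallFieldWidening` — crux r3 `LargeFieldMassRefinementTail` (stmt-QuantumFields-22884) FOLLOWS FROM THE FIRST-EXIT
# WINDOW TAIL of route `FirstExitWindow` (crux stmt-QuantumFields-26243 + support stmt-QuantumFields-26244)
# (support file; width seat `ym-line-sfw-p2-w2` gen 16, line `birth` of lead `ym-line-sfw-p2`)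

THE OBSERVATION.  The crux r3 asks, for a family `F` and a coupling `γ`, for one null sequence `δ n → 0` bounding, for every refinement
depth `n` with `γL^{-n} ≤ γ₁` and EVERY run `K`, the Gibbs mass of the complement of the ALL-HEIGHTS small-field event
`histGood (F.refine n) … K 0`.  A configuration outside that event has a LEAST bad height `j* ≤ K` (tree
`HistoryTailOfTwoSided.compl_histGood_subset_iUnion_finestBad`): at `j* = 0` it lies in the bare large-field event of the finest lattice
(landed `T3BareTailProfile.bareTailAt`: reflection positivity + chessboard); at `j* ≥ 1` every finer block field `Ū^{k}`, `k < j*`, is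
`θ_{b₀}(K−k)`-small, so route `FirstExitWindow`'s deterministic WINDOW `OneStepWindowL` (applied at level `j*−1`) makes `Ū^{j*}`
`θ_{b₂}(K−j*)`-small, while some plaquette `p` of `Ū^{j*}` is `≥ θ_{b₀}(K−j*)`: the configuration lies in the FIRST-EXIT event of `(j*, p)`,
whose Gibbs mass is what the crux `FirstExitWindowTailL` of that route bounds by `C·β_{K−j*}^N·e^{−c·p_{b₀}(g_{K−j*})²}` (§1,
`exists_finestBad_profile`: with the plaquette count `≤ 9·(2L^{m+K−j})³` and the tree's per-height arithmetic
`T3AveragedTailProfile.perHeight_bound` this is a geometric profile `A'·2^{−(K−j)}`).  Run `K` of `F.refine d` at `γL^{-d}` IS run `K + d`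
of `F` with `d` free top steps (landed transport `LargeFieldMassRefinementTailOfHeightTail.gibbsK_refine_real_compl_histGood`), so its mass
is at most `q₀(K + d) + Σ'_t A'·2^{−(t+d)} ≤ Σ'_t q₀(t + d) + 2A'·2^{−d}` (§2), a null sequence in `d` uniformly in `K` — applied to the
least admissible depth `n₀` (the hypotheses are used for the ONE family `F.refine n₀` at `γL^{-n₀} ≤ γ₁` only).

CONSEQUENCE (§3).  `largeFieldMassRefinementTail_of_firstExit : OneStepWindowL → FirstExitWindowTailL → LargeFieldMassRefinementTail` —
a SECOND typed feeder of r3, disjoint from the (α)-record chain (`AveragedTailAt` / `IntCoreRec` / `AlphaInputsT3ACv3RecChi`): no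
per-height tail of the block-averaged fields «whatever happened below» is needed, only the windowed first-exit tail, i.e. (per route
`FirstExitWindow`'s thesis) the small-field half of Bałaban's programme.  `OneStepWindowL` is deterministic and provable from the
tree's one-step smallness propagation; it is kept as a hypothesis here and discharged in its own item file.

WHAT THIS IS NOT: no large-field estimate is proved here — `FirstExitWindowTailL` (stmt-QuantumFields-26243) is an open crux; this file
is a conditional certificate.  Nothing here bears on the Yang–Mills mass gap: rung R3 (`YM3TorusSU2`) is a RECORD rung, not the Clay
statement, and it stays open.

References: T. Bałaban, CMP 102 (1985) 255–275 [Balaban1985UV3] ((7) p.257, (71) p.273); J. Fröhlich, R. Israel, E. Lieb, B. Simon,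
CMP 62 (1978) 1–34 [FrohlichIsraelLiebSimon1978] (chessboard estimate behind the bare term).
-/

noncomputable section

open MeasureTheory Filter Topology
open Literature.MathematicalPhysics.QuantumFieldTheory.Balaban1983to89
open Literature.MathematicalPhysics.QuantumFieldTheory.Balaban1983to89.Missing
open Literature.MathematicalPhysics.QuantumFieldTheory.Balaban1983to89.T4Continuum
open Literature.MathematicalPhysics.QuantumFieldTheory.Balaban1983to89.T3ContinuumYM3Torus
open Literature.MathematicalPhysics.QuantumFieldTheory.Balaban1983to89.T3UnitScaleTilt
open Literature.MathematicalPhysics.QuantumFieldTheory.Balaban1983to89.T3UnitLawDensityEML (ℰp measurableE_ℰp)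
open Literature.MathematicalPhysics.QuantumFieldTheory.Balaban1983to89.T3CruxEstimates
open Literature.MathematicalPhysics.QuantumFieldTheory.Balaban1983to89.T3BareTailProfile
open Literature.MathematicalPhysics.QuantumFieldTheory.Balaban1983to89.T3AveragedTailProfile
open Summit.QuantumFields.YangMills.Theorems.HistoryTailOfTwoSided
open Summit.QuantumFields.YangMills.Theorems.LargeFieldMassRefinementTailOfHeightTail

namespace Summit.QuantumFields.YangMills.Theorems.LargeFieldMassRefinementTailOfFirstExit

/-! ## §1 The finest-bad-level event at an averaged height lies in the first-exit events of its plaquettes -/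

section Engine

variable (F : T3Family) (γ b₀ b₂ p₀ : ℝ)

/-- **FINEST BAD LEVEL ⇒ FIRST EXIT THROUGH THE WINDOW**: if the level-`j` block field being `θ_{b₀}(K−j)`-small forces the level-`j+1`
block field to be `θ_{b₂}(K−j−1)`-small (the WINDOW, one configuration at a time), then a configuration whose level-`j+1` field is NOT
`θ_{b₀}(K−j−1)`-small while all finer levels `i ≤ j` are `θ_{b₀}(K−i)`-small lies, for some level-`j+1` plaquette `p`, in the first-exit
event «small history ∧ `Ū^{j+1}` in the `b₂`-window ∧ `θ_{b₀}(K−j−1) ≤ |Ū^{j+1}(∂p) − 1|». [cite: Balaban1985UV3, (7) p.257] -/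
theorem finestBad_subset_iUnion_firstExit {K j : ℕ}
    (hW : ∀ U : GaugeField (F.P K) 0 (Matrix.specialUnitaryGroup (Fin 2) ℂ),
      PlaqSmall (θBal F.L γ b₀ p₀ (K - j))
          (Averaging.iter (fun i => BlockAveraging.blockAvg (P := F.P K) (j := i) ℰp) j U) →
        PlaqSmall (θBal F.L γ b₂ p₀ (K - (j + 1)))
          (Averaging.iter (fun i => BlockAveraging.blockAvg (P := F.P K) (j := i) ℰp) (j + 1) U)) :
    ({U : GaugeField (F.P K) 0 (Matrix.specialUnitaryGroup (Fin 2) ℂ) |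
        ¬ PlaqSmall (θBal F.L γ b₀ p₀ (K - (j + 1)))
          (Averaging.iter (fun i => BlockAveraging.blockAvg (P := F.P K) (j := i) ℰp) (j + 1) U)} ∩
      {U | ∀ i, i < j + 1 → PlaqSmall (θBal F.L γ b₀ p₀ (K - i))
          (Averaging.iter (fun i' => BlockAveraging.blockAvg (P := F.P K) (j := i') ℰp) i U)}) ⊆
      ⋃ p : Plaq (F.P K) (j + 1),
        {U | (∀ k, k < j + 1 → PlaqSmall (θBal F.L γ b₀ p₀ (K - k))
            (Averaging.iter (fun i => BlockAveraging.blockAvg (P := F.P K) (j := i) ℰp) k U)) ∧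
          PlaqSmall (θBal F.L γ b₂ p₀ (K - (j + 1)))
            (Averaging.iter (fun i => BlockAveraging.blockAvg (P := F.P K) (j := i) ℰp) (j + 1) U) ∧
          θBal F.L γ b₀ p₀ (K - (j + 1)) ≤ GaugeGroup.dist1 (GaugeField.plaqHol
            (Averaging.iter (fun i => BlockAveraging.blockAvg (P := F.P K) (j := i) ℰp) (j + 1) U) p)} := by
  intro U hU
  obtain ⟨hbad, hhist⟩ := hU
  simp only [Set.mem_setOf_eq] at hbad hhist
  have hwin := hW U (hhist j (Nat.lt_succ_self j))
  simp only [PlaqSmall, not_forall, not_lt] at hbad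
  obtain ⟨p, hp⟩ := hbad
  exact Set.mem_iUnion.mpr ⟨p, hhist, hwin, hp⟩

/-- **THE UNION BOUND OVER THE EXIT PLAQUETTE**: for a finite measure `μ`, under the window at level `j`, the mass of the finest-bad-level
event at level `j+1` is at most `#Plaq_{j+1} · B` whenever every first-exit event of a level-`j+1` plaquette has mass `≤ B`.
[cite: Balaban1985UV3, (7) p.257] -/
theorem real_finestBad_le_card_mul {K j : ℕ}
    (μ : Measure (GaugeField (F.P K) 0 (Matrix.specialUnitaryGroup (Fin 2) ℂ))) [IsFiniteMeasure μ]
    (hW : ∀ U : GaugeField (F.P K) 0 (Matrix.specialUnitaryGroup (Fin 2) ℂ),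
      PlaqSmall (θBal F.L γ b₀ p₀ (K - j))
          (Averaging.iter (fun i => BlockAveraging.blockAvg (P := F.P K) (j := i) ℰp) j U) →
        PlaqSmall (θBal F.L γ b₂ p₀ (K - (j + 1)))
          (Averaging.iter (fun i => BlockAveraging.blockAvg (P := F.P K) (j := i) ℰp) (j + 1) U))
    {B : ℝ}
    (hFE : ∀ p : Plaq (F.P K) (j + 1), μ.real
      {U | (∀ k, k < j + 1 → PlaqSmall (θBal F.L γ b₀ p₀ (K - k))
          (Averaging.iter (fun i => BlockAveraging.blockAvg (P := F.P K) (j := i) ℰp) k U)) ∧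
        PlaqSmall (θBal F.L γ b₂ p₀ (K - (j + 1)))
          (Averaging.iter (fun i => BlockAveraging.blockAvg (P := F.P K) (j := i) ℰp) (j + 1) U) ∧
        θBal F.L γ b₀ p₀ (K - (j + 1)) ≤ GaugeGroup.dist1 (GaugeField.plaqHol
          (Averaging.iter (fun i => BlockAveraging.blockAvg (P := F.P K) (j := i) ℰp) (j + 1) U) p)} ≤ B) :
    μ.real ({U : GaugeField (F.P K) 0 (Matrix.specialUnitaryGroup (Fin 2) ℂ) |
        ¬ PlaqSmall (θBal F.L γ b₀ p₀ (K - (j + 1)))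
          (Averaging.iter (fun i => BlockAveraging.blockAvg (P := F.P K) (j := i) ℰp) (j + 1) U)} ∩
      {U | ∀ i, i < j + 1 → PlaqSmall (θBal F.L γ b₀ p₀ (K - i))
          (Averaging.iter (fun i' => BlockAveraging.blockAvg (P := F.P K) (j := i') ℰp) i U)}) ≤
      Fintype.card (Plaq (F.P K) (j + 1)) * B := by
  refine (measureReal_mono (finestBad_subset_iUnion_firstExit F γ b₀ b₂ p₀ hW) (measure_ne_top _ _)).trans ?_
  refine (measureReal_iUnion_fintype_le _).trans ?_
  calc ∑ p : Plaq (F.P K) (j + 1), μ.real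
        {U | (∀ k, k < j + 1 → PlaqSmall (θBal F.L γ b₀ p₀ (K - k))
            (Averaging.iter (fun i => BlockAveraging.blockAvg (P := F.P K) (j := i) ℰp) k U)) ∧
          PlaqSmall (θBal F.L γ b₂ p₀ (K - (j + 1)))
            (Averaging.iter (fun i => BlockAveraging.blockAvg (P := F.P K) (j := i) ℰp) (j + 1) U) ∧
          θBal F.L γ b₀ p₀ (K - (j + 1)) ≤ GaugeGroup.dist1 (GaugeField.plaqHol
            (Averaging.iter (fun i => BlockAveraging.blockAvg (P := F.P K) (j := i) ℰp) (j + 1) U) p)}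
      ≤ ∑ _p : Plaq (F.P K) (j + 1), B := Finset.sum_le_sum fun p _ => hFE p
    _ = Fintype.card (Plaq (F.P K) (j + 1)) * B := by rw [Finset.sum_const, Finset.card_univ, nsmul_eq_mul]

variable {F γ b₀ b₂ p₀}

/-- **THE FINEST-BAD-LEVEL PROFILE OF ONE FAMILY FROM ITS WINDOW AND ITS FIRST-EXIT TAIL** (`0 < γ ≤ 1`, `0 < b₀`, `1 ≤ p₀`): if at
coupling `γ` the family `F` has the one-step window `θ_{b₀}(K−j)`-small `Ū^{j}` ⇒ `θ_{b₂}(K−j−1)`-small `Ū^{j+1}` (every `j + 1 ≤ K`, every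
configuration) and the first-exit tails `Gibbs_K(FE(K, j, p)) ≤ C·β_{K−j}^N·e^{−c·p_{b₀}(g_{K−j})²}` (every `1 ≤ j ≤ K`, every level-`j`
plaquette `p`; `c > 0`, the sign of `C` free), then for some `A' ≥ 0` every finest-bad-level event has Gibbs mass `≤ A'·2^{−(K−j)}`
(`1 ≤ j ≤ K`): union over the `≤ 9·(2L^{m+K−j})³` plaquettes (`HistoryTailOfTwoSided.card_plaq_le_pow`) and the tree's per-height
arithmetic (`T3AveragedTailProfile.perHeight_bound`). [cite: Balaban1985UV3, (7) p.257 and (71) p.273] -/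
theorem exists_finestBad_profile (F : T3Family) {γ b₀ b₂ p₀ : ℝ} (hγ : 0 < γ) (hγ1 : γ ≤ 1) (hb₀ : 0 < b₀)
    (hp₀ : 1 ≤ p₀)
    (hW : ∀ K j : ℕ, j + 1 ≤ K → ∀ U : GaugeField (F.P K) 0 (Matrix.specialUnitaryGroup (Fin 2) ℂ),
      PlaqSmall (θBal F.L γ b₀ p₀ (K - j))
          (Averaging.iter (fun i => BlockAveraging.blockAvg (P := F.P K) (j := i) ℰp) j U) →
        PlaqSmall (θBal F.L γ b₂ p₀ (K - (j + 1)))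
          (Averaging.iter (fun i => BlockAveraging.blockAvg (P := F.P K) (j := i) ℰp) (j + 1) U))
    {C c : ℝ} {N : ℕ} (hc : 0 < c)
    (hFE : ∀ K j : ℕ, 1 ≤ j → j ≤ K → ∀ p : Plaq (F.P K) j, (gibbsK F ℰp γ K).real
      {U | (∀ k, k < j → PlaqSmall (θBal F.L γ b₀ p₀ (K - k))
          (Averaging.iter (fun i => BlockAveraging.blockAvg (P := F.P K) (j := i) ℰp) k U)) ∧
        PlaqSmall (θBal F.L γ b₂ p₀ (K - j))
          (Averaging.iter (fun i => BlockAveraging.blockAvg (P := F.P K) (j := i) ℰp) j U) ∧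
        θBal F.L γ b₀ p₀ (K - j) ≤ GaugeGroup.dist1 (GaugeField.plaqHol
          (Averaging.iter (fun i => BlockAveraging.blockAvg (P := F.P K) (j := i) ℰp) j U) p)} ≤
      C * ((γ * ((F.L : ℝ)⁻¹) ^ (K - j))⁻¹) ^ N *
        Real.exp (-(c * B10.pFun b₀ p₀ (Real.sqrt (γ * ((F.L : ℝ)⁻¹) ^ (K - j))) ^ 2))) :
    ∃ A' : ℝ, 0 ≤ A' ∧ ∀ K j : ℕ, 1 ≤ j → j ≤ K → (gibbsK F ℰp γ K).real
      ({U | ¬ PlaqSmall (θBal F.L γ b₀ p₀ (K - j))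
          (Averaging.iter (fun i => BlockAveraging.blockAvg (P := F.P K) (j := i) ℰp) j U)} ∩
        {U | ∀ i, i < j → PlaqSmall (θBal F.L γ b₀ p₀ (K - i))
          (Averaging.iter (fun i' => BlockAveraging.blockAvg (P := F.P K) (j := i') ℰp) i U)}) ≤
      A' * ((1 : ℝ) / 2) ^ (K - j) := by
  obtain ⟨A', hA'0, hP⟩ := exists_perHeight_bound F hγ hγ1 hb₀ hp₀ (le_max_right C 0) N hc
  refine ⟨A', hA'0, fun K j hj1 hjK => ?_⟩
  obtain ⟨j, rfl⟩ : ∃ j', j = j' + 1 := ⟨j - 1, by omega⟩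
  haveI := isProbabilityMeasure_gibbsK F ℰp hγ.le K
  have hE0 : 0 ≤ max C 0 * (F.scheme ℰp γ).β (K - (j + 1)) ^ N *
      Real.exp (-(c * B10.pFun b₀ p₀ (Real.sqrt (γ * ((F.L : ℝ)⁻¹) ^ (K - (j + 1)))) ^ 2)) :=
    mul_nonneg (mul_nonneg (le_max_right C 0) (pow_nonneg (F.scheme_β_nonneg ℰp hγ.le (K - (j + 1))) N))
      (Real.exp_nonneg _)
  have hB : ∀ p : Plaq (F.P K) (j + 1), (gibbsK F ℰp γ K).real
      {U | (∀ k, k < j + 1 → PlaqSmall (θBal F.L γ b₀ p₀ (K - k))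
          (Averaging.iter (fun i => BlockAveraging.blockAvg (P := F.P K) (j := i) ℰp) k U)) ∧
        PlaqSmall (θBal F.L γ b₂ p₀ (K - (j + 1)))
          (Averaging.iter (fun i => BlockAveraging.blockAvg (P := F.P K) (j := i) ℰp) (j + 1) U) ∧
        θBal F.L γ b₀ p₀ (K - (j + 1)) ≤ GaugeGroup.dist1 (GaugeField.plaqHol
          (Averaging.iter (fun i => BlockAveraging.blockAvg (P := F.P K) (j := i) ℰp) (j + 1) U) p)} ≤
      max C 0 * (F.scheme ℰp γ).β (K - (j + 1)) ^ N *
        Real.exp (-(c * B10.pFun b₀ p₀ (Real.sqrt (γ * ((F.L : ℝ)⁻¹) ^ (K - (j + 1)))) ^ 2)) := by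
    intro p
    refine (hFE K (j + 1) hj1 hjK p).trans ?_
    show C * (F.scheme ℰp γ).β (K - (j + 1)) ^ N *
        Real.exp (-(c * B10.pFun b₀ p₀ (Real.sqrt (γ * ((F.L : ℝ)⁻¹) ^ (K - (j + 1)))) ^ 2)) ≤ _
    exact mul_le_mul_of_nonneg_right
      (mul_le_mul_of_nonneg_right (le_max_left C 0) (pow_nonneg (F.scheme_β_nonneg ℰp hγ.le (K - (j + 1))) N))
      (Real.exp_nonneg _)
  refine (real_finestBad_le_card_mul F γ b₀ b₂ p₀ (gibbsK F ℰp γ K) (hW K j hjK) hB).trans ?_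
  exact (mul_le_mul_of_nonneg_right (card_plaq_le_pow F hjK) hE0).trans (hP (K - (j + 1)))

end Engine

/-! ## §2 Every run of every refinement: the bare term of the run plus the tail of the finest-bad-level profile -/

section Refinement

/-- **ONE RUN OF A REFINED FAMILY FROM THE ORIGINAL FAMILY's TWO PROFILES** (`γ ≥ 0`): if the family `F` at coupling `γ` has bare
large-field masses `Gibbs_{K'}{¬PlaqSmall θ(K')} ≤ q₀ K'` and finest-bad-level masses `≤ q(K' − j)` (`1 ≤ j ≤ K'`; `q ≥ 0` summable), then for
every depth `d` and every run `K` the Gibbs mass (family `F.refine d`, coupling `γL^{-d}`) of the complement of the ALL-HEIGHTS small-field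
event is at most `q₀(K + d) + Σ'_t q(t + d)`: run `K` of `F.refine d` is run `K + d` of `F` with `d` free top steps
(`gibbsK_refine_real_compl_histGood`), decomposed by the least bad height (`real_compl_histGood_le_sum_finestBad`).
[cite: Balaban1985UV3, (7) p.257 and (71) p.273] -/
theorem refine_real_compl_histGood_le (F : T3Family) {γ : ℝ} (hγ : 0 ≤ γ) (b₀ p₀ : ℝ) {q₀ q : ℕ → ℝ}
    (hq0 : ∀ i, 0 ≤ q i) (hq : Summable q)
    (hbare : ∀ K, (gibbsK F ℰp γ K).real {U | ¬ PlaqSmall (θBal F.L γ b₀ p₀ K) U} ≤ q₀ K)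
    (hfb : ∀ K j, 1 ≤ j → j ≤ K → (gibbsK F ℰp γ K).real
      ({U | ¬ PlaqSmall (θBal F.L γ b₀ p₀ (K - j))
          (Averaging.iter (fun i => BlockAveraging.blockAvg (P := F.P K) (j := i) ℰp) j U)} ∩
        {U | ∀ i, i < j → PlaqSmall (θBal F.L γ b₀ p₀ (K - i))
          (Averaging.iter (fun i' => BlockAveraging.blockAvg (P := F.P K) (j := i') ℰp) i U)}) ≤ q (K - j))
    (d K : ℕ) :
    (gibbsK (F.refine d) ℰp (γ * ((F.L : ℝ)⁻¹) ^ d) K).real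
        (histGood (F.refine d) ℰp (θBal (F.refine d).L (γ * ((F.L : ℝ)⁻¹) ^ d) b₀ p₀) K 0)ᶜ ≤
      q₀ (K + d) + ∑' t, q (t + d) := by
  have hθ : θBal (F.refine d).L (γ * ((F.L : ℝ)⁻¹) ^ d) b₀ p₀ = fun i => θBal F.L γ b₀ p₀ (i + d) :=
    funext fun i => θBal_mul_pow F.L γ b₀ p₀ d i
  rw [hθ, gibbsK_refine_real_compl_histGood F ℰp measurableE_ℰp hγ (θBal F.L γ b₀ p₀) d K]
  haveI := isProbabilityMeasure_gibbsK F ℰp hγ (K + d)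
  refine (real_compl_histGood_le_sum_finestBad F ℰp (θBal F.L γ b₀ p₀) (K + d) d (gibbsK F ℰp γ (K + d))).trans ?_
  rw [Nat.add_sub_cancel, Finset.sum_range_succ', add_comm]
  refine add_le_add ?_ ?_
  · exact (measureReal_mono Set.inter_subset_left (measure_ne_top _ _)).trans (hbare (K + d))
  · calc ∑ j ∈ Finset.range K, (gibbsK F ℰp γ (K + d)).real
            ({U | ¬ PlaqSmall (θBal F.L γ b₀ p₀ (K + d - (j + 1)))
                (Averaging.iter (fun i => BlockAveraging.blockAvg (P := F.P (K + d)) (j := i) ℰp) (j + 1) U)} ∩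
              {U | ∀ i, i < j + 1 → PlaqSmall (θBal F.L γ b₀ p₀ (K + d - i))
                (Averaging.iter (fun i' => BlockAveraging.blockAvg (P := F.P (K + d)) (j := i') ℰp) i U)})
          ≤ ∑ j ∈ Finset.range K, q (K + d - (j + 1)) :=
            Finset.sum_le_sum fun j hj => hfb (K + d) (j + 1) (by omega)
              (by have := Finset.mem_range.mp hj; omega)
      _ = ∑ j ∈ Finset.range K, q (j + d) := by
            rw [← Finset.sum_range_reflect (fun j => q (j + d)) K]
            refine Finset.sum_congr rfl fun j hj => ?_
            have := Finset.mem_range.mp hj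
            show q (K + d - (j + 1)) = q (K - 1 - j + d)
            congr 1
            omega
      _ ≤ ∑' t, q (t + d) := ((summable_nat_add_iff d).mpr hq).sum_le_tsum _ fun _ _ => hq0 _

/-- **ONE NULL SEQUENCE FOR ALL RUNS OF ALL ADMISSIBLE REFINEMENTS, FROM THE WINDOW AND THE FIRST-EXIT TAIL** (`γ > 0`, `γ₁ ≤ 1`,
`0 < b₀`, `1 ≤ p₀`, `c > 0`): if every family of block size `F.L` at every coupling `0 < γ' ≤ γ₁` has the one-step window and the
first-exit tail bound with constants `(C, c, N)`, then there is `δ n → 0` bounding, for every depth `n` with `γL^{-n} ≤ γ₁` and every run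
`K`, the Gibbs mass (family `F.refine n`, coupling `γL^{-n}`) of the complement of the all-heights small-field event — namely
`δ n = Σ'_t q₀(t + n − n₀) + Σ'_t A'·2^{−(t + n − n₀)}` for the bare profile `q₀` (`T3BareTailProfile.bareTailAt`) and the finest-bad-level
constant `A'` (§1) of the ONE family `F.refine n₀`, `n₀` the least admissible depth. [cite: Balaban1985UV3, (7) p.257 and (71) p.273] -/
theorem exists_null_of_firstExit (F : T3Family) {γ γ₁ b₀ b₂ p₀ C c : ℝ} {N : ℕ} (hγ : 0 < γ) (hγ₁1 : γ₁ ≤ 1)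
    (hb₀ : 0 < b₀) (hp₀ : 1 ≤ p₀) (hc : 0 < c)
    (hW : ∀ (F' : T3Family) (γ' : ℝ), F'.L = F.L → 0 < γ' → γ' ≤ γ₁ →
      ∀ K j : ℕ, j + 1 ≤ K → ∀ U : GaugeField (F'.P K) 0 (Matrix.specialUnitaryGroup (Fin 2) ℂ),
        PlaqSmall (θBal F'.L γ' b₀ p₀ (K - j))
            (Averaging.iter (fun i => BlockAveraging.blockAvg (P := F'.P K) (j := i) ℰp) j U) →
          PlaqSmall (θBal F'.L γ' b₂ p₀ (K - (j + 1)))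
            (Averaging.iter (fun i => BlockAveraging.blockAvg (P := F'.P K) (j := i) ℰp) (j + 1) U))
    (hFE : ∀ (F' : T3Family) (γ' : ℝ), F'.L = F.L → 0 < γ' → γ' ≤ γ₁ →
      ∀ K j : ℕ, 1 ≤ j → j ≤ K → ∀ p : Plaq (F'.P K) j, (gibbsK F' ℰp γ' K).real
        {U | (∀ k, k < j → PlaqSmall (θBal F'.L γ' b₀ p₀ (K - k))
            (Averaging.iter (fun i => BlockAveraging.blockAvg (P := F'.P K) (j := i) ℰp) k U)) ∧
          PlaqSmall (θBal F'.L γ' b₂ p₀ (K - j))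
            (Averaging.iter (fun i => BlockAveraging.blockAvg (P := F'.P K) (j := i) ℰp) j U) ∧
          θBal F'.L γ' b₀ p₀ (K - j) ≤ GaugeGroup.dist1 (GaugeField.plaqHol
            (Averaging.iter (fun i => BlockAveraging.blockAvg (P := F'.P K) (j := i) ℰp) j U) p)} ≤
        C * ((γ' * ((F'.L : ℝ)⁻¹) ^ (K - j))⁻¹) ^ N *
          Real.exp (-(c * B10.pFun b₀ p₀ (Real.sqrt (γ' * ((F'.L : ℝ)⁻¹) ^ (K - j))) ^ 2))) :
    ∃ δ : ℕ → ℝ, Tendsto δ atTop (𝓝 0) ∧ ∀ n K : ℕ, γ * ((F.L : ℝ)⁻¹) ^ n ≤ γ₁ →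
      (gibbsK (F.refine n) ℰp (γ * ((F.L : ℝ)⁻¹) ^ n) K).real
        (histGood (F.refine n) ℰp (θBal (F.refine n).L (γ * ((F.L : ℝ)⁻¹) ^ n) b₀ p₀) K 0)ᶜ ≤ δ n := by
  classical
  by_cases hex : ∃ n : ℕ, γ * ((F.L : ℝ)⁻¹) ^ n ≤ γ₁
  · have hn₀ : γ * ((F.L : ℝ)⁻¹) ^ Nat.find hex ≤ γ₁ := Nat.find_spec hex
    have hL0 : (0 : ℝ) < F.L := by exact_mod_cast (zero_lt_one.trans F.hL.2)
    have hγ' : 0 < γ * ((F.L : ℝ)⁻¹) ^ Nat.find hex := mul_pos hγ (pow_pos (inv_pos.mpr hL0) _)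
    have hγ'1 : γ * ((F.L : ℝ)⁻¹) ^ Nat.find hex ≤ 1 := hn₀.trans hγ₁1
    -- the two profiles of the ONE family `F.refine n₀` at `γL^{-n₀}`
    obtain ⟨q₀, hq₀0, hq₀, -, hbare⟩ := bareTailAt (F.refine (Nat.find hex)) hγ' hγ'1 hb₀ hp₀
    obtain ⟨A', hA'0, hfb⟩ := exists_finestBad_profile (F.refine (Nat.find hex)) hγ' hγ'1 hb₀ hp₀
      (hW (F.refine (Nat.find hex)) _ rfl hγ' hn₀) hc (hFE (F.refine (Nat.find hex)) _ rfl hγ' hn₀)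
    obtain ⟨hq0, hq, -⟩ := geometric_profile hA'0
    refine ⟨fun n => (∑' t, q₀ (t + (n - Nat.find hex))) +
      ∑' t, A' * ((1 : ℝ) / 2) ^ (t + (n - Nat.find hex)), ?_, fun n K hle => ?_⟩
    · have h0 := (tendsto_sum_nat_add q₀).comp (tendsto_sub_atTop_nat (Nat.find hex))
      have h1 := (tendsto_sum_nat_add (fun i : ℕ => A' * ((1 : ℝ) / 2) ^ i)).comp
        (tendsto_sub_atTop_nat (Nat.find hex))
      have h := h0.add h1
      rw [add_zero] at h
      exact h
    · have hn : Nat.find hex ≤ n := Nat.find_min' hex hle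
      obtain ⟨d, rfl⟩ : ∃ d, n = Nat.find hex + d := ⟨n - Nat.find hex, by omega⟩
      have hd : Nat.find hex + d - Nat.find hex = d := Nat.add_sub_cancel_left _ _
      have hc' : γ * ((F.L : ℝ)⁻¹) ^ (Nat.find hex + d) =
          γ * ((F.L : ℝ)⁻¹) ^ Nat.find hex * ((F.L : ℝ)⁻¹) ^ d := by rw [pow_add, mul_assoc]
      beta_reduce
      rw [hd, hc', ← refine_refine F (Nat.find hex) d]
      refine (refine_real_compl_histGood_le (F.refine (Nat.find hex)) hγ'.le b₀ p₀ hq0 hq hbare hfb d K).trans ?_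
      have h1 : q₀ (K + d) ≤ ∑' t, q₀ (t + d) := by
        have := ((summable_nat_add_iff d).mpr hq₀).sum_le_tsum {K} (fun t _ => hq₀0 (t + d))
        simpa using this
      exact add_le_add h1 le_rfl
  · exact ⟨fun _ => 0, tendsto_const_nhds, fun n K hle => (hex ⟨n, hle⟩).elim⟩

end Refinement

/-! ## §3 The crux BY NAME from route `FirstExitWindow`'s window and first-exit tail -/

section Crux

/-- **r3 ⇐ THE FIRST-EXIT WINDOW TAIL**: `OneStepWindowL → FirstExitWindowTailL → LargeFieldMassRefinementTail` — the crux
`LargeFieldMassRefinementTail` of route `SmallFieldWidening` (stmt-QuantumFields-22884) from the support `OneStepWindowL`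
(stmt-QuantumFields-26244, deterministic) and the crux `FirstExitWindowTailL` (stmt-QuantumFields-26243) of route `FirstExitWindow`, at
the profile `(b₀, p₀) = (1, 3)` and `γ₁ = min γ_W γ_F`.  A conditional certificate: neither hypothesis is proved here, and nothing here
bears on the mass gap (rung R3 is a record rung). [cite: Balaban1985UV3, (7) p.257 and (71) p.273] -/
theorem largeFieldMassRefinementTail_of_firstExit
    (hW : Summit.QuantumFields.YangMills.Theses.FirstExitWindow.OneStepWindowL)
    (hF : Summit.QuantumFields.YangMills.Theses.FirstExitWindow.FirstExitWindowTailL) :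
    Summit.QuantumFields.YangMills.Theses.SmallFieldWidening.LargeFieldMassRefinementTail := by
  intro L
  obtain ⟨b₂, γW, hb₂, hγW, hγW1, hWF⟩ := hW L 1 3 one_pos (by norm_num)
  obtain ⟨γF, C, c, N, hγF, -, hc, hFF⟩ := hF L 1 3 b₂ one_pos (by norm_num) hb₂
  refine ⟨1, 3, min γW γF, one_pos, by norm_num, lt_min hγW hγF, fun F γ hFL hγ => ?_⟩
  exact exists_null_of_firstExit F hγ ((min_le_left _ _).trans hγW1) one_pos (by norm_num) hc
    (fun F' γ' hF'L hγ' hle => hWF F' γ' (hF'L.trans hFL) hγ' (hle.trans (min_le_left _ _)))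
    (fun F' γ' hF'L hγ' hle => hFF F' γ' (hF'L.trans hFL) hγ' (hle.trans (min_le_right _ _)))

end Crux

end Summit.QuantumFields.YangMills.Theorems.LargeFieldMassRefinementTailOfFirstExit

end
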